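import Mathlib
import HarnessLib

/-!
# Cochains with integer periods are integral up to a coboundary

The elementary universal-coefficient statement behind "integral classes have integral Čech
cocycles" (the Čech integrality step of Lefschetz's theorem on `(1,1)`-classes; Weil 1952, §3;
Bott–Tu (1982), Thm. 15.8 with §15 "the isomorphism is compatible with the integral lattices"):

Let `∂ : ℤ^S → ℤ^T` be an integer matrix `B` between finitely generated free abelian groups (the
boundary of a finite chain complex in one degree, `(∂m)_t = ∑_s m_s B_{s t}`) and `c : S → 𝕜` a
cochain with values in a field of characteristic zero. If the PERIODS of `c` over all integer cycles
are integers — `∑_s m_s c_s ∈ ℤ` whenever `∂ m = 0` — then `c` is an INTEGER cochain plus a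
coboundary: `c_s = n_s + ∑_t B_{s t} a_t` with `n : S → ℤ`, `a : T → 𝕜`
(`exists_int_add_coboundary_of_int_periods`).

Proof (Hatcher (2002), §3.1, proof of Thm. 3.2, specialised): the image `∂(ℤ^S) ≤ ℤ^T` is free
(submodule of a free module over a PID, `Submodule.basisOfPid`), so `∂` splits,
`ℤ^S = ker ∂ ⊕ s(im ∂)` (`Module.projective_lifting_property`); the projection of `c` to `ker ∂` is
integer valued by hypothesis, and the remainder `c ∘ s ∘ ∂` factors through `im ∂ ≤ ℤ^T`, whence
extends to `ℤ^T` because `𝕜` is a divisible, hence injective, `ℤ`-module (Baer's criterion,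
`Module.Baer.of_divisible`). No named facts; everything is proved.

## References

* A. Hatcher, *Algebraic Topology* (2002), §3.1, Thm. 3.2 and its proof. [HatcherAT2002]
* R. Bott, L. W. Tu, *Differential Forms in Algebraic Topology* (1982), §15, Thm. 15.8.
  [BottTu1982Forms]
-/

namespace Literature.Algebra.Homology

variable {S T : Type*} [Fintype S] [Fintype T] {𝕜 : Type*} [Field 𝕜] [CharZero 𝕜]

omit [Fintype T] in
/-- The `ℤ`-linear boundary `m ↦ (t ↦ ∑_s m_s B_{s t})` of an integer matrix, on a basis vector:
`∂ e_s = (B_{s t})_t`. [folklore] -/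
theorem vecMul_single_one (B : S → T → ℤ) [DecidableEq S] (s : S) (t : T) :
    Matrix.vecMul (Pi.single s (1 : ℤ)) (Matrix.of B) t = B s t := by
  change dotProduct (Pi.single s (1 : ℤ)) (fun i ↦ Matrix.of B i t) = B s t
  rw [single_dotProduct, one_mul, Matrix.of_apply]

/-- **A cochain with integer periods on all integer cycles is an integer cochain plus a coboundary**
(finite free chain complex in one degree, boundary given by the integer matrix `B`,
`(∂m)_t = ∑_s m_s B_{s t}`; values in a field of characteristic zero). The universal-coefficient
argument of Hatcher (2002), proof of Thm. 3.2: `im ∂` is free so `∂` splits, the `ker ∂`-component of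
`c` is integral by hypothesis, and the rest factors through `im ∂ ≤ ℤ^T` and extends to `ℤ^T` by
injectivity of the divisible group `𝕜`. [cite: HatcherAT2002, §3.1 Thm. 3.2 (proof)] -/
theorem exists_int_add_coboundary_of_int_periods (B : S → T → ℤ) (c : S → 𝕜)
    (h : ∀ m : S → ℤ, (∀ t, ∑ s, m s * B s t = 0) → ∃ z : ℤ, ∑ s, (m s : 𝕜) * c s = z) :
    ∃ (n : S → ℤ) (a : T → 𝕜), ∀ s, c s = n s + ∑ t, (B s t : 𝕜) * a t := by
  classical
  -- the boundary and the cochain as `ℤ`-linear maps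
  set D : (S → ℤ) →ₗ[ℤ] (T → ℤ) := Matrix.vecMulLinear (Matrix.of B) with hD
  have hDapply : ∀ (m : S → ℤ) (t : T), D m t = ∑ s, m s * B s t := fun m t ↦ by
    change dotProduct m (fun i ↦ Matrix.of B i t) = _
    rfl
  set γ : (S → ℤ) →ₗ[ℤ] 𝕜 := Fintype.linearCombination ℤ c with hγ
  have hγapply : ∀ m : S → ℤ, γ m = ∑ s, (m s : 𝕜) * c s := fun m ↦ by
    rw [hγ, Fintype.linearCombination_apply]
    exact Finset.sum_congr rfl fun s _ ↦ by rw [zsmul_eq_mul]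
  -- integrality of `γ` on the cycles
  have hint : ∀ m : S → ℤ, D m = 0 → ∃ z : ℤ, γ m = z := fun m hm ↦ by
    obtain ⟨z, hz⟩ := h m fun t ↦ by rw [← hDapply, hm, Pi.zero_apply]
    exact ⟨z, by rw [hγapply, hz]⟩
  -- the image of `D` is free, hence projective, so `D` splits
  obtain ⟨k, bN⟩ := Submodule.basisOfPid (Pi.basisFun ℤ T) (LinearMap.range D)
  haveI : Module.Free ℤ (LinearMap.range D) := Module.Free.of_basis bN
  obtain ⟨σ, hσ⟩ := Module.projective_lifting_property D.rangeRestrict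
    (LinearMap.id : LinearMap.range D →ₗ[ℤ] LinearMap.range D) D.surjective_rangeRestrict
  -- the projection `p = 𝟙 - σ ∘ D` onto the cycles
  set p : (S → ℤ) →ₗ[ℤ] (S → ℤ) := LinearMap.id - σ ∘ₗ D.rangeRestrict with hp
  have hpD : ∀ m, D (p m) = 0 := fun m ↦ by
    have h1 : D (σ (D.rangeRestrict m)) = D m := by
      have e := LinearMap.congr_fun hσ (D.rangeRestrict m)
      rw [LinearMap.comp_apply, LinearMap.id_apply] at e
      have e' := congrArg (fun x : LinearMap.range D ↦ (x : T → ℤ)) e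
      simpa only [LinearMap.codRestrict_apply] using e'
    rw [hp, LinearMap.sub_apply, LinearMap.id_apply, LinearMap.comp_apply, map_sub, h1, sub_self]
  -- the integer part
  choose nf hnf using fun m ↦ hint (p m) (hpD m)
  -- the coboundary part: extend `γ ∘ σ` from `im D` to `ℤ^T` (Baer: `𝕜` is divisible)
  obtain ⟨a', ha'⟩ := (Module.Baer.of_divisible 𝕜).extension_property (LinearMap.range D).subtype
    Subtype.val_injective (γ ∘ₗ σ)
  refine ⟨fun s ↦ nf (Pi.single s 1), fun t ↦ a' (Pi.single t 1), fun s ↦ ?_⟩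
  -- `c s = γ e_s = γ (p e_s) + γ (σ (D e_s))`
  have hcs : c s = γ (Pi.single s 1) := by
    rw [hγapply, Finset.sum_eq_single s (fun b _ hb ↦ by rw [Pi.single_eq_of_ne hb, Int.cast_zero, zero_mul])
      (fun h ↦ (h (Finset.mem_univ s)).elim), Pi.single_eq_same, Int.cast_one, one_mul]
  have hsplit : (Pi.single s 1 : S → ℤ) = p (Pi.single s 1) + σ (D.rangeRestrict (Pi.single s 1)) := by
    rw [hp, LinearMap.sub_apply, LinearMap.id_apply, LinearMap.comp_apply, sub_add_cancel]
  have hγσ : γ (σ (D.rangeRestrict (Pi.single s 1))) = a' (D (Pi.single s 1)) := by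
    have e := LinearMap.congr_fun ha' (D.rangeRestrict (Pi.single s 1))
    rw [LinearMap.comp_apply, LinearMap.comp_apply, Submodule.subtype_apply] at e
    rw [← e]
    rfl
  -- `a' (D e_s) = ∑_t B_{s t} a_t`
  have hDe : D (Pi.single s 1) = ∑ t, B s t • (Pi.single t (1 : ℤ) : T → ℤ) := by
    funext t
    rw [Finset.sum_apply, Finset.sum_eq_single t (fun b _ hb ↦ by
        rw [Pi.smul_apply, Pi.single_eq_of_ne (Ne.symm hb) , smul_zero])
      (fun h ↦ (h (Finset.mem_univ t)).elim), Pi.smul_apply, Pi.single_eq_same, smul_eq_mul, mul_one,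
      hD, Matrix.coe_vecMulLinear]
    exact vecMul_single_one B s t
  rw [hcs, hsplit, map_add, hnf, hγσ, hDe, map_sum]
  congr 1
  exact Finset.sum_congr rfl fun t _ ↦ by rw [map_zsmul, zsmul_eq_mul]

end Literature.Algebra.Homology
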